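import Summits.BirchSwinnertonDyer.BirchSwinnertonDyer.Theorems.ManinLocalTwoThreeOldformsSixty
import HarnessLib

/-!
# Level 60 (`4 ∣ 60`, genus `7`), part 2: `X₀(60)` has NO newform — the seven old forms fill `S₂(Γ₀(60))` — so C2 holds at
# `N = 60` vacuously — FACT-FREE

Cell bsd-f2-manin, route `ManinLocalTwoThree` (crux C2 `ManinOddAtFour`, stmt-22967: `2² ∣ 60`), prover seat p2 gen 27; sequel to `…OldformsSixty`
(seven old forms `F₁ = f₁₅`, `F₂ = ι₂f₁₅`, `F₃ = ι₄f₁₅`, `F₄ = f₂₀`, `F₅ = ι₃f₂₀`, `F₆ = b₃₀ = η₃η₅η₆η₁₀`, `F₇ = ι₂b₃₀` with an invertible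
`7 × 7` matrix of Fourier coefficients `aₙ`, `n ≤ 7`).

* §3 The seven forms lie in `S₂(Γ₀(60))^{old}` and are linearly independent (the coefficient functionals `a₁, …, a₇` and an explicit inverse
  matrix); `μ(60) = 144`, `ν_∞ = 12`, `ν₂ = ν₃ = 0`, `g(X₀(60)) = 7 = dim S₂(Γ₀(60))`; hence `S₂(Γ₀(60))^{old} = S₂(Γ₀(60))` and, old and new
  being disjoint (tree `disjoint_oldSubspace0_newSubspace0_holds`), **`S₂(Γ₀(60))^{new} = 0`**: no newform of level `60` (there is no
  elliptic curve of conductor `60`).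
* §4 **No `X₀(60)`-datum exists**; C2's `∀`-statement at `N = 60` holds vacuously (`maninOddAtFour_sixty`).

With `28` (`…NoNewformTwentyEight`) this settles the two NEWFORM-FREE levels of the C2 domain below `64`; the levels `20, 24, 32, 36, 40, 48`
are settled by `|c| = 1`.  No definition, no named fact, no sorry.  Nothing here proves C2 for all `N`, Manin's conjecture or BSD.
[cite: AtkinLehner1970, Thm. 5] [cite: DiamondShurman2005, §5.6, Thm. 3.5.1] [cite: CremonaAlgorithms1997, Table 3]
-/

set_option autoImplicit false
-- lint-debt: the directory name repeats the summit name (sibling precedent `ManinLocalTwoThreeOldformsSixty.lean`)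
set_option linter.dupNamespace false

noncomputable section

open Complex Filter Topology Set Function Asymptotics Polynomial
open UpperHalfPlane hiding I
open scoped Real Topology Manifold MatrixGroups ModularForm
open ModularForm CongruenceSubgroup Matrix.SpecialLinearGroup
open Literature.NumberTheory.ModularForms
open Literature.NumberTheory.EllipticCurves Literature.NumberTheory.EllipticCurves.ModularForms

namespace Summit.BirchSwinnertonDyer.BirchSwinnertonDyer.Theorems.ManinLocalTwoThree.NoNewformSixty

open CuspToolkit

/-! ## §3 The old subspace is everything; the new subspace is zero -/

/-- `μ(Γ₀(60)) = 144`, `ν_∞ = 12`, `ν₂ = ν₃ = 0`. [cite: DiamondShurman2005, §3.8] -/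
theorem gamma0_data_60 : gamma0Index 60 = 144 ∧ nuInfty 60 = 12 ∧ nu₂ 60 = 0 ∧ nu₃ 60 = 0 :=
  ⟨(gamma0Index_mul (m := 4) (n := 15) (by norm_num)).trans
      (by rw [show (4 : ℕ) = 2 ^ 2 by norm_num, gamma0Index_prime_pow (p := 2) (e := 2) Nat.prime_two (by norm_num),
        gamma0Index_mul (m := 3) (n := 5) (by norm_num), gamma0Index_prime Nat.prime_three, gamma0Index_prime Nat.prime_five]; norm_num),
    by decide, by rw [nu₂_eq_card]; decide, by rw [nu₃_eq_card]; decide⟩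

/-- `g(X₀(60)) = 7`. [cite: DiamondShurman2005, Thm. 3.1.1] -/
theorem genusX0_sixty : genusX0 60 = 7 := by
  obtain ⟨h1, h2, h3, h4⟩ := gamma0_data_60
  rw [genusX0, h1, h2, h3, h4]

/-- **`dim S₂(Γ₀(60)) = 7`.** [cite: DiamondShurman2005, Thm. 3.5.1] -/
theorem finrank_cuspForm_two_sixty : Module.finrank ℂ (CuspForm (Gamma0 60) 2) = 7 := by
  have h := finrank_cuspForm_two_eq_genusX0_holds 60
  unfold finrank_cuspForm_two_eq_genusX0 at h
  rw [h, genusX0_sixty]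

/-- A degeneracy image from a level `M ∈ {15, 20, 30}` lies in `S₂(Γ₀(60))^{old}`. [cite: AtkinLehner1970, §2] -/
theorem degeneracyMap0_mem_old {M : ℕ} [NeZero M] (d : ℕ) [NeZero d] (hidx : (M, d) ∈ {x : ℕ × ℕ | x.1 ∈ Nat.properDivisors 60 ∧ x.1 * x.2 ∣ 60})
    (f : CuspForm (Gamma0 M) 2) : degeneracyMap0 M 60 d 2 f ∈ oldSubspace0 60 2 := by
  rw [oldSubspace0]
  exact Submodule.mem_iSup_of_mem ⟨(M, d), hidx⟩ (LinearMap.mem_range_self _ _)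

section B

variable (B : CuspForm (Gamma0 30) 2) (hB : ⇑B = etaQuotient 30 (expFn [(3, 1), (5, 1), (6, 1), (10, 1)]))
include hB

/-- **The seven old forms are linearly independent** (apply `a₁, …, a₇` to a vanishing combination and invert the coefficient matrix).
[folklore] -/
theorem linearIndependent_oldforms :
    LinearIndependent ℂ ![degeneracyMap0 15 60 1 2 cuspFormEta15, degeneracyMap0 15 60 2 2 cuspFormEta15,
      degeneracyMap0 15 60 4 2 cuspFormEta15, degeneracyMap0 20 60 1 2 cuspFormEtaProductTwenty,
      degeneracyMap0 20 60 3 2 cuspFormEtaProductTwenty, degeneracyMap0 30 60 1 2 B, degeneracyMap0 30 60 2 2 B] := by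
  rw [Fintype.linearIndependent_iff]
  intro g hg
  obtain ⟨⟨a1, a2, a3, a4, a5, a6, a7⟩, ⟨b1, b2, b3, b4, b5, b6, b7⟩, ⟨c1, c2, c3, c4, c5, c6, c7⟩, ⟨d1, d2, d3, d4, d5, d6, d7⟩,
    ⟨e1', e2', e3', e4', e5', e6', e7'⟩, ⟨f1, f2, f3, f4, f5, f6, f7⟩, ⟨g1, g2, g3, g4, g5, g6, g7⟩⟩ := cuspCoeff_table B hB
  have key : ∀ n : ℕ, ∑ i : Fin 7, g i * cuspCoeff (![degeneracyMap0 15 60 1 2 cuspFormEta15, degeneracyMap0 15 60 2 2 cuspFormEta15,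
      degeneracyMap0 15 60 4 2 cuspFormEta15, degeneracyMap0 20 60 1 2 cuspFormEtaProductTwenty,
      degeneracyMap0 20 60 3 2 cuspFormEtaProductTwenty, degeneracyMap0 30 60 1 2 B, degeneracyMap0 30 60 2 2 B] i) n = 0 := by
    intro n
    have h := congrArg (cuspCoeff · n) hg
    rw [cuspCoeff_sum_smul, cuspCoeff, CuspForm.coe_zero, UpperHalfPlane.qExpansion_zero, map_zero] at h
    exact h
  have e1 := key 1
  have e2 := key 2
  have e3 := key 3
  have e4 := key 4
  have e5 := key 5
  have e6 := key 6
  have e7 := key 7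
  simp only [Fin.sum_univ_seven, Matrix.cons_val_zero, Matrix.cons_val_one, Matrix.cons_val] at e1 e2 e3 e4 e5 e6 e7
  rw [a1, b1, c1, d1, e1', f1, g1] at e1
  rw [a2, b2, c2, d2, e2', f2, g2] at e2
  rw [a3, b3, c3, d3, e3', f3, g3] at e3
  rw [a4, b4, c4, d4, e4', f4, g4] at e4
  rw [a5, b5, c5, d5, e5', f5, g5] at e5
  rw [a6, b6, c6, d6, e6', f6, g6] at e6
  rw [a7, b7, c7, d7, e7', f7, g7] at e7
  have h0 : g 0 = 0 := by linear_combination (1 / 3 : ℂ) * e1 + (2 / 3 : ℂ) * e5 + (1 / 6 : ℂ) * e7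
  have h1 : g 1 = 0 := by linear_combination (1 / 2 : ℂ) * e5 + (-1 / 2 : ℂ) * e6 + (1 / 4 : ℂ) * e7
  have h2 : g 2 = 0 := by
    linear_combination (1 / 6 : ℂ) * e1 + (1 / 4 : ℂ) * e4 + (1 / 3 : ℂ) * e5 + (-1 / 4 : ℂ) * e6 + (1 / 12 : ℂ) * e7
  have h3 : g 3 = 0 := by linear_combination (1 / 3 : ℂ) * e1 + (-1 / 3 : ℂ) * e5 + (1 / 6 : ℂ) * e7
  have h4 : g 4 = 0 := by linear_combination (1 / 3 : ℂ) * e1 + (1 / 3 : ℂ) * e3 + (1 / 6 : ℂ) * e7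
  have h5 : g 5 = 0 := by linear_combination (1 / 3 : ℂ) * e1 + (-1 / 3 : ℂ) * e5 + (-1 / 3 : ℂ) * e7
  have h6 : g 6 = 0 := by
    linear_combination (1 / 6 : ℂ) * e1 + (1 / 2 : ℂ) * e2 + (-1 / 6 : ℂ) * e5 + (1 / 2 : ℂ) * e6 + (-1 / 6 : ℂ) * e7
  intro i
  fin_cases i
  · exact h0
  · exact h1
  · exact h2
  · exact h3
  · exact h4
  · exact h5
  · exact h6

/-- **`S₂(Γ₀(60))^{old} = S₂(Γ₀(60))`** (seven independent old forms in a `7`-dimensional space). [cite: AtkinLehner1970, Thm. 5] -/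
theorem oldSubspace0_sixty_eq_top : oldSubspace0 60 2 = ⊤ := by
  haveI : FiniteDimensional ℂ (CuspForm (Gamma0 60) 2) := finiteDimensional_cuspForm_gamma0 60 2
  have m1 := degeneracyMap0_mem_old (M := 15) 1 (by decide) cuspFormEta15
  have m2 := degeneracyMap0_mem_old (M := 15) 2 (by decide) cuspFormEta15
  have m3 := degeneracyMap0_mem_old (M := 15) 4 (by decide) cuspFormEta15
  have m4 := degeneracyMap0_mem_old (M := 20) 1 (by decide) cuspFormEtaProductTwenty
  have m5 := degeneracyMap0_mem_old (M := 20) 3 (by decide) cuspFormEtaProductTwenty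
  have m6 := degeneracyMap0_mem_old (M := 30) 1 (by decide) B
  have m7 := degeneracyMap0_mem_old (M := 30) 2 (by decide) B
  have hv : LinearIndependent ℂ ![(⟨_, m1⟩ : oldSubspace0 60 2), ⟨_, m2⟩, ⟨_, m3⟩, ⟨_, m4⟩, ⟨_, m5⟩, ⟨_, m6⟩, ⟨_, m7⟩] := by
    refine LinearIndependent.of_comp (oldSubspace0 60 2).subtype ?_
    convert linearIndependent_oldforms B hB using 1
    funext i
    fin_cases i <;> rfl
  have h7 : 7 ≤ Module.finrank ℂ (oldSubspace0 60 2) := by simpa using hv.fintype_card_le_finrank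
  exact Submodule.eq_top_of_finrank_eq (by
    have := Submodule.finrank_le (oldSubspace0 60 2)
    rw [finrank_cuspForm_two_sixty] at this ⊢
    omega)

/-- **`S₂(Γ₀(60))^{new} = 0`**: there is no newform of level `60`. [cite: AtkinLehner1970, Thm. 5] -/
theorem newSubspace0_sixty_eq_bot : newSubspace0 60 2 = ⊥ := by
  have hdisj : Disjoint (oldSubspace0 60 2) (newSubspace0 60 2) := disjoint_oldSubspace0_newSubspace0_holds (N := 60) (k := 2)
  rw [oldSubspace0_sixty_eq_top B hB] at hdisj
  exact top_disjoint.mp hdisj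

end B

/-- **No normalised newform of weight `2` and level `60` exists.** [cite: CremonaAlgorithms1997, Table 3] -/
theorem not_isNewform0_sixty (g : CuspForm (Gamma0 60) 2) : ¬ IsNewform0 g := by
  intro hg
  obtain ⟨B, hB⟩ := exists_cuspForm_b30
  have h0 : g = 0 := by
    have h := hg.1
    rw [newSubspace0_sixty_eq_bot B hB, Submodule.mem_bot] at h
    exact h
  have h1 : cuspCoeff g 1 = 1 := hg.2.2
  rw [h0, cuspCoeff, CuspForm.coe_zero, UpperHalfPlane.qExpansion_zero, map_zero] at h1
  exact zero_ne_one h1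

/-! ## §4 The `X₀(60)`-domain of C2 is empty; C2 at `N = 60` -/

/-- **No Weierstrass curve has an `X₀(60)`-datum** (a datum carries a newform of level `60`). [cite: CremonaAlgorithms1997, Table 3] -/
theorem isEmpty_modularParametrizationData_sixty (W : WeierstrassCurve ℚ) : IsEmpty (ModularParametrizationData W 60) :=
  ⟨fun D ↦ not_isNewform0_sixty D.f D.isNewformOf.1⟩

/-- `2² ∣ 60`: the level `60` lies in C2's `4 ∣ N` world. [folklore] -/
theorem two_sq_dvd_sixty : 2 ^ 2 ∣ 60 := ⟨15, by norm_num⟩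

/-- **The C2 conclusion on the whole `X₀(60)`-domain, vacuously**: `|c| = 1 ∧ 2 ∤ c` for every lattice-optimal `X₀(60)`-datum of every globally
minimal elliptic curve over `ℚ` — there is none (and `2² ∣ 60`).  FACT-FREE; BSD and C2 for general `N` are NOT proved by this. [folklore] -/
theorem maninOddAtFour_sixty :
    2 ^ 2 ∣ 60 ∧ ∀ (W : WeierstrassCurve ℚ) [W.IsElliptic] [W.IsGloballyMinimal] (D : ModularParametrizationData W 60),
      (∀ z ∈ D.L.lattice, ∃ w ∈ periodLattice D.f, z = D.c * w) → |D.maninConstant| = 1 ∧ ¬ (2 : ℤ) ∣ D.maninConstant :=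
  ⟨two_sq_dvd_sixty, fun W _ _ D _ ↦ ((isEmpty_modularParametrizationData_sixty W).false D).elim⟩

end Summit.BirchSwinnertonDyer.BirchSwinnertonDyer.Theorems.ManinLocalTwoThree.NoNewformSixty

end
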